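import Literature.Computability.MetaComplexity.UniversalMachine
import Literature.Computability.Complexity.ClockedUniversalSimulationProofs
import HarnessLib

/-!
# Non-vacuity of `UniversalMachine`: reduction to clocked universal simulation

Sibling proof file of `UniversalMachine.lean` for the named fact
`Literature.CplxMeta.UniversalMachine.nonempty := Nonempty UniversalMachine` (D-0014 style: facts are
`def X : Prop`, discharges are `theorem X_holds : X`).

The printed theorem behind `nonempty` is the **efficient universal Turing machine**
(Arora–Barak 2009, Thm. 1.9, book p. 20: "there exists a TM `U` such that for every
`x, α ∈ {0,1}*`, `U(x, α) = M_α(x)` … if `M_α` halts on input `x` within `T` steps then `U(x, α)`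
halts within `C T log T` steps, where `C` depends only on `M_α`") in its **clocked** form
(loc. cit. §1.4.1, "Universal TM with time bound", p. 21: "a variant of `U` that gets a number
`T` as an extra input and outputs `M_α(x)` if and only if `M_α` halts on `x` within `T` steps …
by adding a time counter"), the `T log T` overhead being Hennie–Stearns 1966, Thm. 1 (J. ACM 13,
p. 541: "the number of operations of `M₂` needed to simulate `n` operations of `M_k` is at most
`a n log₂ n`"); the relaxed polynomial-overhead version, which is all `UniversalMachine.sim`
asks for, is Hartmanis–Stearns 1965 (Arora–Barak, proof of the relaxed Thm. 1.9, p. 20, and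
chapter notes p. 36).

Transporting this to Mathlib's multi-stack model `Turing.FinTM2` (arbitrary finite stack index
type, label type, state type; `TM2.Stmt` trees; halting convention `Turing.haltList`) is a
whole theory (normal-form compilation of `TM2.Stmt` programs, Boolean encodings of tables and
configurations, an interpreter machine with a verified polynomial step count, a clocked
iteration combinator, pairing/projection machines, and machine composition — of which only the
last exists: `Literature.Computability.Complexity.PolyTimeComputable.comp_holds`). This file isolates that theory as
ONE named fact and proves that nothing else is needed:

* `clockedUniversalSimulation : Prop` — there is a clocked interpreter
  `run : List Bool → ℕ → Option (List Bool)` which is monotone in the budget, polynomial-time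
  computable by a TM2 machine on the input `boolPair prog (unaryEncodeNat t)`, and simulates
  every `Turing.TM2ComputableAux Bool Bool` with polynomial overhead (fields `run`, `run_mono`,
  `polyTime`, `sim` of `UniversalMachine`). [Arora–Barak 2009, Thm. 1.9 and §1.4.1;
  Hennie–Stearns 1966, Thm. 1]
* `print_of_sim` (proved): the remaining field `print` of `UniversalMachine` — cheap printing
  programs, Liu–Pass's standing convention `K^t(x) ≤ |x| + c` for `t(n) ≥ (1+ε)n` — is a
  *consequence* of `sim` and `run_mono` in this model: Mathlib's identity machine
  `Turing.idComputer` halts after **one** step on every input (`id_outputsWithin_one`), so `sim`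
  yields a code `e` and a polynomial `p` with `run (boolPair e x) (p.eval 1) = some x` for every
  `x`; the program `boolPair e x` has length `|x| + (2|e| + 2)` and the constant budget
  `p.eval 1` is below `⌈(1+ε)|x|⌉` as soon as `|x| ≥ p.eval 1`.
* `nonempty_of_clockedUniversalSimulation`, `nonempty_iff_clockedUniversalSimulation` (proved):
  `nonempty ↔ clockedUniversalSimulation`.

So the discharge `nonempty_holds` is reduced, without loss, to `clockedUniversalSimulation`.
The latter is now a theorem of the tree: `Complexity/ClockedUniversalSimulationProofs.lean`
carries out the plan (normal form → universal step machine → clocked iteration → read-out)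
and proves the three-field statement verbatim as
`Complexity.ClockedUS.clockedUniversalSimulation_holds'` (an explicit interpreter
`ClockedUS.run` with `run_mono`, `polyTime_run`, `sim`). Hence, at the end of this file:

* `clockedUniversalSimulation_holds : clockedUniversalSimulation` — the discharge, by that
  theorem;
* `nonempty_holds : nonempty` — the discharge of the named fact of `UniversalMachine.lean`,
  through `nonempty_of_clockedUniversalSimulation`.

## References

* S. Arora, B. Barak, *Computational Complexity: A Modern Approach*, CUP 2009, Thm. 1.9
  (efficient universal TM), §1.4.1 (universal TM with time bound), §1.7, chapter notes.
  doi:10.1017/cbo9780511804090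
* F. C. Hennie, R. E. Stearns, *Two-tape simulation of multitape Turing machines*, J. ACM 13
  (1966) 533–546, Thm. 1. doi:10.1145/321356.321362
* Y. Liu, R. Pass, *On one-way functions and Kolmogorov complexity*, FOCS 2020, §2.2 (the
  conventions on `U` bundled in `UniversalMachine`).
-/

namespace Literature.Computability.MetaComplexity.UniversalMachine

open _root_.Computability Complexity Turing

/-- **Clocked efficient universal simulation in Mathlib's TM2 model** (the content of
`UniversalMachine` minus the derivable field `print`): there is a clocked interpreter
`run : List Bool → ℕ → Option (List Bool)` (read `run prog t` as "the output of `U(prog, 1^t)`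
if the universal machine halts within budget `t`") such that
(i) outputs are stable under enlarging the budget;
(ii) `(prog, t) ↦ run prog t` is polynomial-time computable by a TM2 machine on the input
`boolPair prog (unaryEncodeNat t)`, output encoded by `(encodingList Bool).optionBool`;
(iii) every `M : Turing.TM2ComputableAux Bool Bool` has a code `e` and an overhead polynomial
`p` with `M.OutputsWithin w y t → run (boolPair e w) (p.eval t) = some y`.
This is Arora–Barak's Thm. 1.9 in the clocked form of §1.4.1 ("a variant of `U` that gets a
number `T` as an extra input and outputs `M_α(x)` iff `M_α` halts on `x` within `T` steps"),
with polynomial (rather than `C_M · T log T`, Hennie–Stearns 1966 Thm. 1) overhead, transported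
to multi-stack machines `Turing.FinTM2`. [cite: AroraBarak2009, Thm. 1.9 and §1.4.1] -/
def clockedUniversalSimulation : Prop :=
  ∃ run : List Bool → ℕ → Option (List Bool),
    (∀ {prog : List Bool} {t t' : ℕ} {y : List Bool},
        t ≤ t' → run prog t = some y → run prog t' = some y) ∧
    PolyTimeComputable (fun q : List Bool × ℕ => boolPair q.1 (unaryEncodeNat q.2))
      ((encodingList Bool).optionBool).encode (Function.uncurry run) ∧
    ∀ M : Turing.TM2ComputableAux Bool Bool, ∃ (e : List Bool) (p : Polynomial ℕ),
      ∀ (w y : List Bool) (t : ℕ), M.OutputsWithin w y t → run (boolPair e w) (p.eval t) = some y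

/-- A bundled `Turing.TM2ComputableInPolyTime ea eb f` machine outputs `eb (f a)` on `ea a`
within `time (ea a).length` steps, in the Prop-valued language `OutputsWithin` (Mathlib states
`outputsFun` with `Equiv.invFun`, `OutputsWithin` with `Equiv.symm`). [Mathlib
`Turing.TM2ComputableInPolyTime.outputsFun`] [folklore] -/
theorem outputsWithin_of_tm2ComputableInPolyTime {α β Γ₀ Γ₁ : Type} {ea : α → List Γ₀}
    {eb : β → List Γ₁} {f : α → β} (M : TM2ComputableInPolyTime ea eb f) (a : α) :
    M.toTM2ComputableAux.OutputsWithin (ea a) (eb (f a)) (M.time.eval (ea a).length) := by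
  have h := M.outputsFun a
  simp only [Equiv.invFun_as_coe] at h
  exact ⟨h⟩

/-- Mathlib's identity machine on Boolean strings (`Turing.idComputer Bool`, whose single
statement is `halt` and whose input stack is its output stack), bundled as a
`TM2ComputableAux Bool Bool`. [Mathlib `Turing.idComputableInPolyTime`] [folklore] -/
noncomputable def idMachine : TM2ComputableAux Bool Bool :=
  (idComputableInPolyTime (αΓ := Bool) (@id (List Bool))).toTM2ComputableAux

/-- The identity machine outputs its input after **one** step, on every input.
[Mathlib `Turing.idComputableInPolyTime` (`time := 1`)] [folklore] -/
theorem id_outputsWithin_one (x : List Bool) : idMachine.OutputsWithin x x 1 := by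
  have h := outputsWithin_of_tm2ComputableInPolyTime
    (idComputableInPolyTime (αΓ := Bool) (@id (List Bool))) x
  have ht : (idComputableInPolyTime (αΓ := Bool) (@id (List Bool))).time = 1 := rfl
  rw [ht, Polynomial.eval_one] at h
  exact h

/-- **`print` is derivable from `sim` and `run_mono`.** For a clocked interpreter that is
monotone in the budget and simulates every TM2 machine with polynomial overhead, every `ε > 0`
admits constants `c, n₀` such that each `x` with `|x| ≥ n₀` is printed by a program of length
`≤ |x| + c` within `⌈(1+ε)|x|⌉` budget: take the code `e` and overhead `p` of the identity
machine (which halts in one step), `c = 2|e| + 2`, `n₀ = p.eval 1`, program `boolPair e x`.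
(Liu–Pass 2020, §2.2 take this as a convention on `U`; here it is a theorem about any
universal `U` in the sense of `sim`.) [cite: AroraBarak2009, Thm. 1.9 and §1.4.1] -/
theorem print_of_sim {run : List Bool → ℕ → Option (List Bool)}
    (mono : ∀ {prog : List Bool} {t t' : ℕ} {y : List Bool},
      t ≤ t' → run prog t = some y → run prog t' = some y)
    (sim : ∀ M : Turing.TM2ComputableAux Bool Bool, ∃ (e : List Bool) (p : Polynomial ℕ),
      ∀ (w y : List Bool) (t : ℕ), M.OutputsWithin w y t → run (boolPair e w) (p.eval t) = some y) :
    ∀ ε : ℝ, 0 < ε → ∃ c n₀ : ℕ, ∀ x : List Bool, n₀ ≤ x.length →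
      ∃ prog : List Bool, prog.length ≤ x.length + c ∧ run prog ⌈(1 + ε) * x.length⌉₊ = some x := by
  intro ε hε
  obtain ⟨e, p, h⟩ := sim idMachine
  refine ⟨2 * e.length + 2, p.eval 1, fun x hx => ⟨boolPair e x, ?_, ?_⟩⟩
  · rw [length_boolPair]; omega
  · refine mono ?_ (h x x 1 (id_outputsWithin_one x))
    have h1 : ((p.eval 1 : ℕ) : ℝ) ≤ (1 + ε) * x.length := by
      have hx' : ((p.eval 1 : ℕ) : ℝ) ≤ x.length := by exact_mod_cast hx
      have hn : (0 : ℝ) ≤ x.length := Nat.cast_nonneg _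
      nlinarith
    exact Nat.cast_le.mp (h1.trans (Nat.le_ceil _))

/-- **`nonempty` from clocked universal simulation**: a clocked interpreter with properties
(i)–(iii) of `clockedUniversalSimulation` is a `UniversalMachine`, the printing field being
supplied by `print_of_sim`. [cite: AroraBarak2009, Thm. 1.9 and §1.4.1] -/
theorem nonempty_of_clockedUniversalSimulation (h : clockedUniversalSimulation) : nonempty := by
  obtain ⟨run, mono, poly, sim⟩ := h
  exact ⟨⟨run, mono, poly, sim, print_of_sim mono sim⟩⟩

/-- Conversely every `UniversalMachine` witnesses `clockedUniversalSimulation` (projection on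
the first four fields). [cite: AroraBarak2009, Thm. 1.9 and §1.4.1] -/
theorem clockedUniversalSimulation_of_nonempty (h : nonempty) : clockedUniversalSimulation := by
  obtain ⟨U⟩ := h
  exact ⟨U.run, U.run_mono, U.polyTime, U.sim⟩

/-- The named fact `nonempty` is *equivalent* to `clockedUniversalSimulation`: the reduction of
this file loses nothing. [cite: AroraBarak2009, Thm. 1.9 and §1.4.1] -/
theorem nonempty_iff_clockedUniversalSimulation : nonempty ↔ clockedUniversalSimulation :=
  ⟨clockedUniversalSimulation_of_nonempty, nonempty_of_clockedUniversalSimulation⟩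

/-! ### The discharges -/

/-- **Discharge of `clockedUniversalSimulation`.** The clocked efficient universal machine for
Mathlib's multi-stack model exists: `Complexity.ClockedUS.run` (interpreter of flat programs with a
frozen-when-halted round function and a decoded read-out) is monotone in the budget,
polynomial-time on `boolPair prog (unaryEncodeNat t)`, and simulates every
`Turing.TM2ComputableAux Bool Bool` with polynomial overhead
(`Complexity.ClockedUS.clockedUniversalSimulation_holds'`, whose statement is this fact's body
verbatim). [cite: AroraBarak2009, Thm. 1.9 and §1.4.1] -/
theorem clockedUniversalSimulation_holds : clockedUniversalSimulation :=
  Complexity.ClockedUS.clockedUniversalSimulation_holds'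

/-- **Discharge of `UniversalMachine.nonempty`** (`UniversalMachine.lean`): a universal machine in
the sense of Liu–Pass's standing conventions — clocked runs stable under enlarging the budget,
polynomial-time interpreter, polynomial-overhead simulation of every TM2 machine, cheap printing
programs — exists in Mathlib's `Turing.FinTM2` model; from `clockedUniversalSimulation_holds` by
`nonempty_of_clockedUniversalSimulation` (the printing field being `print_of_sim`).
[cite: AroraBarak2009, Thm. 1.9 and §1.4.1] -/
theorem nonempty_holds : nonempty :=
  nonempty_of_clockedUniversalSimulation clockedUniversalSimulation_holds

end Literature.Computability.MetaComplexity.UniversalMachine
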